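import Mathlib
import Literature.NumberTheory.LFunctions.Zhang2022.Section7cStatements
import Literature.NumberTheory.LFunctions.Zhang2022.SkeletonWindowPowers
import HarnessLib

/-!
# Zhang (2022), slice L2-t4: the small moduli `1 < r < D` — the Lemma 5.6 step `§7.u033`, proved

Topic `Literature/NumberTheory/LFunctions/Zhang2022` (Landau–Siegel audit tree; verdict-neutral).
Companion of `Section7cStatements` (typed claims of Y. Zhang, arXiv:2211.02515v1, §7 pp. 37–39).
After (7.14) the manuscript says (tex L2016, p.38):

> By Lemma 5.6, the right side is `≪ hrl⁻¹P²D^{−c}` if `θ` is primitive and `1 < r < D`.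

typed as `Step7u033 c′`: for every `k` there are `c > 0` and `C` with
`𝓛ᵏ·(hr/l)·∫ |Σ_{p∼P} θ̄(p)p^{1+it+β₃}| dt/(1+t²) ≤ C·(hr/l)·P²·D^{−c}` for all large `D` under (A),
`1 < r < D`, `θ (mod r)` primitive. This THEOREM-ONLY file PROVES it (`step7u033_holds`, `c = 1/8`,
`C = 6(max C₅₆ 0·π + J)·8ᵏk!` with `C₅₆` the constant of Lemma 5.6 and `J = ∫ (1+t²)^{−3/4} dt`):

* on `|t| ≤ D − 1`: Lemma 5.6 (`Skeleton.lemma56_holds`, a theorem of the tree) applied to the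
  primitive character `θ̄ (mod r)` — `θ̄ ≠ χ (mod Dr)` because the conductors `r ≠ D` differ
  (`DirichletCharacter.conductor_inv`, `conductor_changeLevel`), `r < D ≤ T` — at the real point
  `t + Im β₃` (`β₃ = 3iα(1 − c′α𝓛)` is imaginary with `|Im β₃| ≤ 1` once `𝓛 ≥ 3π(1+|c′|)`), giving
  `|Σ_{p∼P} θ̄(p)p^{1+it+β₃}| ≤ C₅₆𝔓e^{−𝓛^{9/2}}`;
* on `|t| > D − 1`: the trivial bound `𝔓` against `(1+t²)⁻¹ ≤ (1+(D−1)²)^{−1/4}(1+t²)^{−3/4}`, the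
  last factor integrable (`integrable_rpow_neg_one_add_norm_sq`);
* `𝔓 ≤ 6P²`, `e^{−𝓛^{9/2}} ≤ D⁻¹ ≤ D^{−1/4}`, `(1+(D−1)²)^{−1/4} ≤ D^{−1/4}`, `𝓛ᵏ ≤ 8ᵏk!D^{1/8}`.

So the printed per-term claim is TRUE with a power saving `D^{−1/8}`; whether such a saving suffices
for the aggregation over `1 < r < D` (`Step7bSmallR`) is a separate node (GAP-LEDGER G-adj2-1, prior
read1-9) and is not asserted here. No definitions, no new named facts; nothing is asserted about
Theorems 1–2 of the manuscript or about Landau–Siegel zeros.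

## References

* Y. Zhang, arXiv:2211.02515v1 (2022), §7 p. 38, tex L2016; §5 Lemma 5.6 p. 11.
  [cite: Zhang2022LandauSiegel, §7 p.38]
-/

noncomputable section

open Complex Real MeasureTheory
open Literature.NumberTheory.LFunctions.Zhang2022

namespace Literature.NumberTheory.LFunctions.Zhang2022.Section7cStatements

/-- `𝓛 ≥ 1` once `D ≥ 3`. [folklore] -/
private theorem one_le_ell {D : ℕ} (hD : 3 ≤ D) : 1 ≤ Skeleton.ell D := by
  have hD' : (3 : ℝ) ≤ D := by exact_mod_cast hD
  rw [Skeleton.ell, Real.le_log_iff_exp_le (by linarith)]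
  exact le_trans (le_of_lt (lt_trans Real.exp_one_lt_d9 (by norm_num))) hD'

/-- `P = exp(𝓛⁹) ≥ 1`. [folklore] -/
private theorem one_le_bigP (D : ℕ) : 1 ≤ Skeleton.bigP D :=
  Real.one_le_exp (by rw [Skeleton.ell]; positivity)

/-- The poly-log versus power-saving comparison `𝓛ᵏ ≤ 8ᵏ·k!·e^{𝓛/8}` (from `xᵏ/k! ≤ eˣ`).
[folklore] -/
private theorem ell_pow_le (k : ℕ) {D : ℕ} (hD : 3 ≤ D) :
    Skeleton.ell D ^ k ≤ 8 ^ k * k.factorial * Real.exp (Skeleton.ell D / 8) := by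
  have hL : 0 ≤ Skeleton.ell D := zero_le_one.trans (one_le_ell hD)
  have h := Real.pow_div_factorial_le_exp (Skeleton.ell D / 8) (by positivity) k
  rw [div_pow, div_div, div_le_iff₀ (by positivity)] at h
  calc Skeleton.ell D ^ k ≤ Real.exp (Skeleton.ell D / 8) * (8 ^ k * k.factorial) := h
    _ = 8 ^ k * k.factorial * Real.exp (Skeleton.ell D / 8) := by ring

/-- `Re β₃ = 0`. [cite: Zhang2022LandauSiegel, §2 (2.13)] -/
private theorem beta3_re_eq_zero (c' : ℝ) (D : ℕ) : (Skeleton.beta3 c' D).re = 0 := by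
  simp [Skeleton.beta3, Complex.mul_re, Complex.mul_im]

/-- `𝔓 ≥ 0`. [folklore] -/
private theorem frakP_nonneg' (D : ℕ) : 0 ≤ frakP D := by
  rw [Skeleton.frakP_eq_sum_primeWindow]; exact Finset.sum_nonneg fun p _ => Nat.cast_nonneg p

/-- `𝔓 = Σ_{p∼P} p ≤ 6P²` (at most `3P` members, each `≤ 2P`; `D ≥ 3`). [folklore] -/
private theorem frakP_le {D : ℕ} (hD : 3 ≤ D) : frakP D ≤ 6 * Skeleton.bigP D ^ 2 := by
  have hL1 := one_le_ell hD
  have hP1 : 1 ≤ Skeleton.bigP D := one_le_bigP D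
  rw [Skeleton.frakP_eq_sum_primeWindow]
  have hcard : ((Skeleton.primeWindow D).card : ℝ) ≤ 3 * Skeleton.bigP D := by
    have hℓ : (Skeleton.ell D ^ 68)⁻¹ ≤ 1 := inv_le_one_of_one_le₀ (one_le_pow₀ hL1)
    have h1 : (Skeleton.primeWindow D).card ≤
        ⌈Skeleton.bigP D * (1 + (Skeleton.ell D ^ 68)⁻¹)⌉₊ := by
      unfold Skeleton.primeWindow
      refine (Finset.card_filter_le _ _).trans ?_
      rw [Nat.card_Ioo]; omega
    have h2 : (⌈Skeleton.bigP D * (1 + (Skeleton.ell D ^ 68)⁻¹)⌉₊ : ℝ) <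
        Skeleton.bigP D * (1 + (Skeleton.ell D ^ 68)⁻¹) + 1 := Nat.ceil_lt_add_one (by positivity)
    have h3 : Skeleton.bigP D * (1 + (Skeleton.ell D ^ 68)⁻¹) ≤ 2 * Skeleton.bigP D := by
      nlinarith
    have h1' : ((Skeleton.primeWindow D).card : ℝ) ≤
        ⌈Skeleton.bigP D * (1 + (Skeleton.ell D ^ 68)⁻¹)⌉₊ := by exact_mod_cast h1
    linarith
  calc ∑ p ∈ Skeleton.primeWindow D, (p : ℝ)
      ≤ ∑ p ∈ Skeleton.primeWindow D, 2 * Skeleton.bigP D :=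
        Finset.sum_le_sum fun p hp => Skeleton.le_two_mul_bigP_of_mem_primeWindow hL1 hp
    _ = (Skeleton.primeWindow D).card * (2 * Skeleton.bigP D) := by
        rw [Finset.sum_const, nsmul_eq_mul]
    _ ≤ 3 * Skeleton.bigP D * (2 * Skeleton.bigP D) := by gcongr
    _ = 6 * Skeleton.bigP D ^ 2 := by ring

/-- The trivial bound `|Σ_{p∼P} θ̄(p)p^{s}| ≤ 𝔓` on `Re s = 1`. [folklore] -/
private theorem norm_pPoly_le (D r : ℕ) (θ : DirichletCharacter ℂ r) {s : ℂ} (hs : s.re = 1) :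
    ‖pPoly D r θ s‖ ≤ frakP D := by
  unfold pPoly
  rw [Skeleton.frakP_eq_sum_primeWindow]
  refine (norm_sum_le _ _).trans (Finset.sum_le_sum fun p hp => ?_)
  have hp0 : 0 < p := (Finset.mem_filter.mp hp).2.pos
  rw [norm_mul, Complex.norm_natCast_cpow_of_pos hp0, hs, Real.rpow_one]
  calc ‖θ⁻¹ (p : ZMod r)‖ * (p : ℝ) ≤ 1 * p := by
        gcongr; exact DirichletCharacter.norm_le_one _ _
    _ = p := one_mul _

/-- A primitive character has a primitive inverse. [folklore] -/
private theorem isPrimitive_inv {r : ℕ} {θ : DirichletCharacter ℂ r} (hθ : θ.IsPrimitive) :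
    θ⁻¹.IsPrimitive := by
  rw [DirichletCharacter.isPrimitive_def, DirichletCharacter.conductor_inv]; exact hθ

/-- "`θ̄ ≠ χ`" as characters `(mod Dr)`: a primitive character to a modulus `1 < r < D` and the
primitive `χ (mod D)` have different conductors. [folklore] -/
private theorem changeLevel_inv_ne {D r : ℕ} [NeZero D] {χ : DirichletCharacter ℂ D}
    (hχ : χ.IsPrimitive) {θ : DirichletCharacter ℂ r} (hθ : θ.IsPrimitive) (hr : 1 < r)
    (hrD : r < D) :
    DirichletCharacter.changeLevel (Nat.dvd_mul_left r D) θ⁻¹ ≠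
      DirichletCharacter.changeLevel (Nat.dvd_mul_right D r) χ := by
  haveI : NeZero r := ⟨by omega⟩
  intro heq
  have h := congrArg DirichletCharacter.conductor heq
  rw [DirichletCharacter.conductor_changeLevel, DirichletCharacter.conductor_changeLevel,
    DirichletCharacter.conductor_inv] at h
  rw [DirichletCharacter.isPrimitive_def] at hθ hχ
  rw [hθ, hχ] at h
  omega

set_option maxHeartbeats 400000 in
/-- `Z22:§7.u033` CLAIM, PROVED as typed: "By Lemma 5.6, the right side [of (7.14)] is
`≪ hrl⁻¹P²D^{−c}` if `θ` is primitive and `1 < r < D`" — for every `k` with `c = 1/8`: on `|t| ≤ D − 1`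
Lemma 5.6 (`Skeleton.lemma56_holds`, a theorem of the tree) at `t + Im β₃` for the primitive character
`θ̄ ≠ χ (mod Dr)` gives `|Σ_{p∼P} θ̄(p)p^{1+it+β₃}| ≤ C𝔓e^{−𝓛^{9/2}}`; on `|t| > D − 1` the trivial bound
`𝔓` against `(1+t²)⁻¹ ≤ (1+(D−1)²)^{−1/4}(1+t²)^{−3/4}`; `𝔓 ≤ 6P²`, `e^{−𝓛^{9/2}} ≤ D⁻¹`,
`(1+(D−1)²)^{−1/4} ≤ D^{−1/4}`, and `𝓛ᵏ ≤ 8ᵏk!D^{1/8}`.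
[cite: Zhang2022LandauSiegel, §7 p.38, tex L2016] -/
theorem step7u033_holds (c' : ℝ) : Step7u033 c' := by
  intro k
  obtain ⟨C₅₆, D₅₆, h56⟩ := Skeleton.lemma56_holds
  obtain ⟨Dℓ, hDℓ⟩ := Skeleton.exists_nat_forall_le_ell (3 * π * (1 + |c'|) + 2)
  set J : ℝ := ∫ t : ℝ, ((1 : ℝ) + ‖t‖ ^ 2) ^ (-(3 / 2 : ℝ) / 2) with hJdef
  have hJ0 : 0 ≤ J := integral_nonneg fun t => by positivity
  refine ⟨1 / 8, by norm_num, 6 * (max C₅₆ 0 * π + J) * (8 ^ k * k.factorial),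
    max (max D₅₆ Dℓ) 3, fun D _ χ hD hq hp hA r h l θ h1r hrD hθ hh hl => ?_⟩
  have hD56 : D₅₆ ≤ D := le_trans (le_trans (le_max_left _ _) (le_max_left _ _)) hD
  have hDℓ' : Dℓ ≤ D := le_trans (le_trans (le_max_right _ _) (le_max_left _ _)) hD
  have hD3 : 3 ≤ D := le_trans (le_max_right _ _) hD
  have hL1 : 1 ≤ Skeleton.ell D := one_le_ell hD3
  have hLM : 3 * π * (1 + |c'|) + 2 ≤ Skeleton.ell D := hDℓ D hDℓ'
  have hLk := ell_pow_le k hD3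
  have hfrakP : frakP D ≤ 6 * Skeleton.bigP D ^ 2 := frakP_le hD3
  have hfrakP0 : 0 ≤ frakP D := frakP_nonneg' D
  set L := Skeleton.ell D with hLdef
  set P := Skeleton.bigP D with hPdef
  have hπc : 0 ≤ 3 * π * (1 + |c'|) := by positivity
  have hL2 : 2 ≤ L := by linarith
  have hL0 : 0 < L := by linarith
  have hD0 : (0 : ℝ) < D := by exact_mod_cast (show 0 < D by omega)
  have hD1 : (1 : ℝ) ≤ D := by exact_mod_cast (show 1 ≤ D by omega)
  have hlogD : Real.log (D : ℝ) = L := by rw [hLdef, Skeleton.ell]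
  haveI : NeZero r := ⟨by omega⟩
  -- `r < D ≤ T`
  have hrT : (r : ℝ) < Skeleton.bigT D := by
    have h1 : L ≤ L ^ (1.1 : ℝ) := by
      calc L = L ^ (1 : ℝ) := (Real.rpow_one L).symm
        _ ≤ L ^ (1.1 : ℝ) := Real.rpow_le_rpow_of_exponent_le hL1 (by norm_num)
    calc (r : ℝ) < D := by exact_mod_cast hrD
      _ = Real.exp L := by rw [← hlogD, Real.exp_log hD0]
      _ ≤ Real.exp (L ^ (1.1 : ℝ)) := Real.exp_le_exp.2 h1
      _ = Skeleton.bigT D := by rw [Skeleton.bigT]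
  -- `β₃ = ib` with `|b| ≤ 1`
  set α := Skeleton.alpha D with hαdef
  set b : ℝ := (3 : ℕ) * α * (1 - c' * α * L) with hbdef
  have hβ : Skeleton.beta3 c' D = (b : ℂ) * I := Skeleton.beta3_eq_mul_I c' D
  have hα0 : 0 < α := Skeleton.alpha_pos' hL0
  have hb1 : |b| ≤ 1 := by
    have hαL : α * L ≤ 1 := Skeleton.alpha_mul_ell_le_one hL2
    have hαle : α ≤ π / L := by
      rw [hαdef, Skeleton.alpha, Skeleton.log_bigP]
      exact div_le_div_of_nonneg_left pi_pos.le hL0 (le_self_pow₀ hL1 (by norm_num))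
    have h1 : |1 - c' * α * L| ≤ 1 + |c'| := by
      calc |1 - c' * α * L| ≤ |(1 : ℝ)| + |c' * α * L| := abs_sub _ _
        _ = 1 + |c'| * (α * L) := by
            rw [abs_one, mul_assoc, abs_mul, abs_of_nonneg (by positivity : 0 ≤ α * L)]
        _ ≤ 1 + |c'| * 1 := by gcongr
        _ = 1 + |c'| := by ring
    have h3 : |b| = 3 * α * |1 - c' * α * L| := by
      rw [hbdef, abs_mul, abs_of_nonneg (by positivity : (0 : ℝ) ≤ (3 : ℕ) * α)]; push_cast; ring
    rw [h3]
    calc 3 * α * |1 - c' * α * L| ≤ 3 * (π / L) * (1 + |c'|) := by gcongr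
      _ = 3 * π * (1 + |c'|) / L := by ring
      _ ≤ 1 := by rw [div_le_one hL0]; linarith
  -- the dominating function
  set a : ℝ := (D : ℝ) - 1 with hadef
  have ha2 : 2 ≤ a := by
    have : (3 : ℝ) ≤ D := by exact_mod_cast hD3
    rw [hadef]; linarith
  set K₁ : ℝ := max C₅₆ 0 * frakP D * Real.exp (-(L ^ ((9 : ℝ) / 2))) with hK₁def
  set K₃ : ℝ := frakP D * (1 + a ^ 2) ^ (-(1 / 4 : ℝ)) with hK₃def
  have hK₁0 : 0 ≤ K₁ := by positivity
  have hK₃0 : 0 ≤ K₃ := by positivity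
  set g : ℝ → ℝ := fun t => K₁ * (1 + t ^ 2)⁻¹ + K₃ * ((1 : ℝ) + ‖t‖ ^ 2) ^ (-(3 / 2 : ℝ) / 2)
    with hgdef
  have hint₁ : Integrable fun t : ℝ => K₁ * (1 + t ^ 2)⁻¹ := integrable_inv_one_add_sq.const_mul K₁
  have hint₂ : Integrable fun t : ℝ => K₃ * ((1 : ℝ) + ‖t‖ ^ 2) ^ (-(3 / 2 : ℝ) / 2) := by
    refine (integrable_rpow_neg_one_add_norm_sq ?_).const_mul K₃
    rw [Module.finrank_self]; norm_num
  have hg_int : Integrable g := hint₁.add hint₂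
  -- the pointwise bound
  have hpt : ∀ t : ℝ,
      ‖pPoly D r θ (1 + t * I + Skeleton.beta3 c' D)‖ / (1 + t ^ 2) ≤ g t := by
    intro t
    have hre : (1 + t * I + Skeleton.beta3 c' D).re = 1 := by
      simp [Complex.add_re, beta3_re_eq_zero]
    have htriv : ‖pPoly D r θ (1 + t * I + Skeleton.beta3 c' D)‖ ≤ frakP D :=
      norm_pPoly_le D r θ hre
    have h1t : 0 < 1 + t ^ 2 := by positivity
    by_cases ht : |t| ≤ a
    · -- Lemma 5.6 at `t + b`
      have htb : |t + b| ≤ D := by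
        calc |t + b| ≤ |t| + |b| := abs_add_le _ _
          _ ≤ a + 1 := add_le_add ht hb1
          _ = D := by rw [hadef]; ring
      have h56' := h56 D χ hD56 hq hp hA r h1r hrT θ⁻¹ (isPrimitive_inv hθ)
        (changeLevel_inv_ne hp hθ h1r hrD) (t + b) htb
      have heq : pPoly D r θ (1 + t * I + Skeleton.beta3 c' D) =
          ∑ p ∈ Skeleton.primeWindow D,
            θ⁻¹ (p : ZMod r) * (p : ℂ) ^ (1 + ((t + b : ℝ) : ℂ) * I) := by
        unfold pPoly
        refine Finset.sum_congr rfl fun p _ => ?_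
        rw [hβ]; push_cast; ring_nf
      have hK : ‖pPoly D r θ (1 + t * I + Skeleton.beta3 c' D)‖ ≤ K₁ := by
        rw [heq]
        refine h56'.trans ?_
        rw [hK₁def]
        gcongr
        exact le_max_left _ _
      calc ‖pPoly D r θ (1 + t * I + Skeleton.beta3 c' D)‖ / (1 + t ^ 2)
          = ‖pPoly D r θ (1 + t * I + Skeleton.beta3 c' D)‖ * (1 + t ^ 2)⁻¹ := div_eq_mul_inv _ _
        _ ≤ K₁ * (1 + t ^ 2)⁻¹ := by gcongr
        _ ≤ g t := le_add_of_nonneg_right (by positivity)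
    · -- the tail `|t| > D - 1`: trivial bound
      have ht' : a < |t| := not_le.mp ht
      have h1a : 0 < 1 + a ^ 2 := by positivity
      have hta : 1 + a ^ 2 ≤ 1 + t ^ 2 := by nlinarith [sq_abs t, abs_nonneg t, ht']
      have hsplit :
          (1 + t ^ 2)⁻¹ = (1 + t ^ 2) ^ (-(1 / 4 : ℝ)) * (1 + t ^ 2) ^ (-(3 / 4 : ℝ)) := by
        rw [← Real.rpow_add h1t, ← Real.rpow_neg_one]; norm_num
      have hq1 : (1 + t ^ 2) ^ (-(1 / 4 : ℝ)) ≤ (1 + a ^ 2) ^ (-(1 / 4 : ℝ)) :=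
        Real.rpow_le_rpow_of_nonpos h1a hta (by norm_num)
      have hnorm : ((1 : ℝ) + ‖t‖ ^ 2) ^ (-(3 / 2 : ℝ) / 2) = (1 + t ^ 2) ^ (-(3 / 4 : ℝ)) := by
        rw [Real.norm_eq_abs, sq_abs]; norm_num
      calc ‖pPoly D r θ (1 + t * I + Skeleton.beta3 c' D)‖ / (1 + t ^ 2)
          = ‖pPoly D r θ (1 + t * I + Skeleton.beta3 c' D)‖ * (1 + t ^ 2)⁻¹ := div_eq_mul_inv _ _
        _ ≤ frakP D * ((1 + a ^ 2) ^ (-(1 / 4 : ℝ)) * (1 + t ^ 2) ^ (-(3 / 4 : ℝ))) := by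
            rw [hsplit]; gcongr
        _ = K₃ * ((1 : ℝ) + ‖t‖ ^ 2) ^ (-(3 / 2 : ℝ) / 2) := by rw [hnorm, hK₃def]; ring
        _ ≤ g t := le_add_of_nonneg_left (by positivity)
  -- the integral
  have hI : ∫ t : ℝ, ‖pPoly D r θ (1 + t * I + Skeleton.beta3 c' D)‖ / (1 + t ^ 2) ≤
      K₁ * π + K₃ * J := by
    calc ∫ t : ℝ, ‖pPoly D r θ (1 + t * I + Skeleton.beta3 c' D)‖ / (1 + t ^ 2)
        ≤ ∫ t : ℝ, g t :=
          integral_mono_of_nonneg (Filter.Eventually.of_forall fun t => by positivity)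
            hg_int (Filter.Eventually.of_forall hpt)
      _ = K₁ * π + K₃ * J := by
          rw [hgdef, integral_add hint₁ hint₂, integral_const_mul, integral_const_mul,
            integral_univ_inv_one_add_sq]
  -- sizes of `K₁`, `K₃`
  have hexp : Real.exp (-(L ^ ((9 : ℝ) / 2))) ≤ (D : ℝ) ^ (-(1 / 4 : ℝ)) := by
    have h1 : L ≤ L ^ ((9 : ℝ) / 2) := by
      calc L = L ^ (1 : ℝ) := (Real.rpow_one L).symm
        _ ≤ L ^ ((9 : ℝ) / 2) := Real.rpow_le_rpow_of_exponent_le hL1 (by norm_num)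
    have h3 : Real.exp (-L) = (D : ℝ) ^ (-(1 : ℝ)) := by
      rw [Real.rpow_def_of_pos hD0, hlogD]; ring_nf
    calc Real.exp (-(L ^ ((9 : ℝ) / 2))) ≤ Real.exp (-L) := Real.exp_le_exp.2 (by linarith)
      _ = (D : ℝ) ^ (-(1 : ℝ)) := h3
      _ ≤ (D : ℝ) ^ (-(1 / 4 : ℝ)) := Real.rpow_le_rpow_of_exponent_le hD1 (by norm_num)
  have hDa : (D : ℝ) ≤ 1 + a ^ 2 := by
    have h3 : (3 : ℝ) ≤ D := by exact_mod_cast hD3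
    have hnn : 0 ≤ ((D : ℝ) - 1) * ((D : ℝ) - 2) := mul_nonneg (by linarith) (by linarith)
    have e : 1 + a ^ 2 - (D : ℝ) = ((D : ℝ) - 1) * ((D : ℝ) - 2) := by rw [hadef]; ring
    linarith only [hnn, e]
  have ha' : (1 + a ^ 2) ^ (-(1 / 4 : ℝ)) ≤ (D : ℝ) ^ (-(1 / 4 : ℝ)) :=
    Real.rpow_le_rpow_of_nonpos hD0 hDa (by norm_num)
  have hK₁ : K₁ ≤ max C₅₆ 0 * (6 * P ^ 2) * (D : ℝ) ^ (-(1 / 4 : ℝ)) := by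
    rw [hK₁def]
    exact mul_le_mul (mul_le_mul_of_nonneg_left hfrakP (le_max_right _ _)) hexp
      (Real.exp_pos _).le (by positivity)
  have hK₃ : K₃ ≤ 6 * P ^ 2 * (D : ℝ) ^ (-(1 / 4 : ℝ)) := by
    rw [hK₃def]; exact mul_le_mul hfrakP ha' (Real.rpow_nonneg (by positivity) _) (by positivity)
  have hI' : ∫ t : ℝ, ‖pPoly D r θ (1 + t * I + Skeleton.beta3 c' D)‖ / (1 + t ^ 2) ≤
      (max C₅₆ 0 * π + J) * (6 * P ^ 2) * (D : ℝ) ^ (-(1 / 4 : ℝ)) := by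
    calc ∫ t : ℝ, ‖pPoly D r θ (1 + t * I + Skeleton.beta3 c' D)‖ / (1 + t ^ 2)
        ≤ K₁ * π + K₃ * J := hI
      _ ≤ (max C₅₆ 0 * (6 * P ^ 2) * (D : ℝ) ^ (-(1 / 4 : ℝ))) * π +
          (6 * P ^ 2 * (D : ℝ) ^ (-(1 / 4 : ℝ))) * J :=
          add_le_add (mul_le_mul_of_nonneg_right hK₁ pi_pos.le)
            (mul_le_mul_of_nonneg_right hK₃ hJ0)
      _ = (max C₅₆ 0 * π + J) * (6 * P ^ 2) * (D : ℝ) ^ (-(1 / 4 : ℝ)) := by ring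
  have hI0 : 0 ≤ ∫ t : ℝ, ‖pPoly D r θ (1 + t * I + Skeleton.beta3 c' D)‖ / (1 + t ^ 2) :=
    integral_nonneg fun t => by positivity
  have hE : Real.exp (L / 8) = (D : ℝ) ^ (1 / 8 : ℝ) := by
    rw [Real.rpow_def_of_pos hD0, hlogD]; congr 1; ring
  have hLk' : L ^ k ≤ 8 ^ k * k.factorial * (D : ℝ) ^ (1 / 8 : ℝ) := by rw [← hE]; exact hLk
  have hX0 : 0 ≤ ((h * r : ℕ) : ℝ) / l := by positivity
  calc L ^ k * (((h * r : ℕ) : ℝ) / l) *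
        ∫ t : ℝ, ‖pPoly D r θ (1 + t * I + Skeleton.beta3 c' D)‖ / (1 + t ^ 2)
      ≤ (8 ^ k * k.factorial * (D : ℝ) ^ (1 / 8 : ℝ)) * (((h * r : ℕ) : ℝ) / l) *
          ((max C₅₆ 0 * π + J) * (6 * P ^ 2) * (D : ℝ) ^ (-(1 / 4 : ℝ))) :=
        mul_le_mul (mul_le_mul_of_nonneg_right hLk' hX0) hI' hI0 (by positivity)
    _ = 6 * (max C₅₆ 0 * π + J) * (8 ^ k * k.factorial) * (((h * r : ℕ) : ℝ) / l) * P ^ 2 *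
          ((D : ℝ) ^ (1 / 8 : ℝ) * (D : ℝ) ^ (-(1 / 4 : ℝ))) := by ring
    _ = 6 * (max C₅₆ 0 * π + J) * (8 ^ k * (k.factorial : ℝ)) * (((h * r : ℕ) : ℝ) / l) * P ^ 2 *
          (D : ℝ) ^ (-(1 / 8 : ℝ)) := by rw [← Real.rpow_add hD0]; norm_num

end Literature.NumberTheory.LFunctions.Zhang2022.Section7cStatements
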